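import Mathlib
import Literature.Probability.Percolation.DiagonalStripScalarPinning
import HarnessLib

/-!
# Uniqueness of the boundary qKZ solution up to an invariant factor (IP12 §3.4 (20)–(22))

Topic `Literature/Probability/Percolation`. Ikhlef–Ponsaing (J. Stat. Phys. 149 (2012),
arXiv:1202.5476) §3.4 use, as all the physics literature does, that "the" solution of the boundary
qKZ system (20)–(22) — bulk exchange `Ř_i(z_i/z_{i+1}) Ψ(z) = Ψ(s_i z)` at every level and the two
reflections `Ψ(1/z_1, …) = Ψ`, `Ψ(…, 1/z_L) = Ψ` — is unique up to normalisation. Over the rapidity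
field `F = Frac ℂ[w, z_1, z_2, …]` the precise statement proved here is:

**any two solutions of the EXACT system (all bulk levels, both reflections with the same monomial
twist) supported on the physical sector are `F`-proportional.**

Mechanism (the translation `t_1` of the affine Weyl group `C̃_L` acts trivially on `F`): composing the
exchange relations along the word `σ_1 ⋯ σ_{L-1} ι_L σ_{L-1} ⋯ σ_1 ι_1` (the identity automorphism of
`F`) shows that every solution `v` on the connectivity basis satisfies `v = v ᵥ* Y` for ONE explicit
matrix `Y` (a product of `4m` Baxterised factors `R_i(u) = ([q/u] - [u] e_i)/[q u]`); at the point
`z_1 = z_3 = ⋯ = 2`, `z_2 = z_4 = ⋯ = 2q²` the first `2m` factors evaluate alternately to `e_i`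
(`i` odd) and `1` (`i` even), so that their product is the constant map onto the one-block state, and
the remaining factors are regular with row sums one; hence the left kernel of `Y - 1` is a line at
that point, the adjugate of `Y - 1` is nonzero there and therefore generically, and any two vectors of
the left kernel of `Y - 1` over `F` are proportional.

Main results: `ncExchange_matrix` (the exchange relation on the connectivity basis in matrix form),
`ncSolution_vecMul_cocycleY` (`v ᵥ* (Y - 1) = 0`), `cocycleY_eq_prodD` (closed form of `Y`),
`adjugate_cocycleY_sub_one_ne_zero`, **`ncQKZ_solutions_proportional`**,
**`qKZ_solutions_proportional`** (pattern level), the repackaged exact ground state with equal twists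
`exists_groundState_exact_sameTwist`, and **`qKZ_solution_eq_smul_groundState`** (every exact solution
supported on the physical sector is a rapidity-field multiple of the primitive ground state `P`).

This is the (U_qKZ) input that identifies the ground state with ANY explicitly constructed solution of
(20)–(22) (Di Francesco–Zinn-Justin's integral solution, de Gier–Pyatov's factorised solution,
Hagendorf–Liénardy's vertex solution), so that degree bounds transfer to `P`.

## References

* Y. Ikhlef, A. K. Ponsaing, *Finite-size left-passage probability in percolation*, J. Stat. Phys.
  149 (2012) 10–36, arXiv:1202.5476, §3.4 (20)–(22). [IkhlefPonsaing2012]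
* P. Di Francesco, P. Zinn-Justin, *Quantum Knizhnik–Zamolodchikov equation: reflecting boundary
  conditions and combinatorics*, J. Stat. Mech. (2007) P12009, arXiv:0709.3410, §3.2 (uniqueness of
  the solution with prescribed base component). [DiFrancescoZinnJustin2007]
-/

namespace Literature.Probability.Percolation

open Finset Literature.Probability.LatticeModels Literature.Probability.LatticeModels.TemperleyLieb

/-! ### Deterministic-map matrices and Baxterised factors -/

section MapMatrices

open _root_.Matrix

variable {α : Type*} [Fintype α] [DecidableEq α] {R S : Type*} [CommRing R] [CommRing S]

/-- The 0/1 matrix of a map of states (row `s` is `δ_{G s}`): right multiplication pushes row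
vectors forward along `G`. [folklore] -/
def mapMat (R : Type*) [CommRing R] (G : α → α) : Matrix α α R :=
  Matrix.of fun s s' => if G s = s' then 1 else 0

omit [Fintype α] in
/-- Entries of `mapMat`. [folklore] -/
theorem mapMat_apply (G : α → α) (s s' : α) : mapMat R G s s' = if G s = s' then 1 else 0 := rfl

/-- Pushing a row vector forward: fiber sums. [folklore] -/
theorem vecMul_mapMat (x : α → R) (G : α → α) (s' : α) :
    (x ᵥ* mapMat R G) s' = ∑ s ∈ Finset.univ.filter (fun s => G s = s'), x s := by
  rw [vecMul, dotProduct, Finset.sum_filter]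
  refine Finset.sum_congr rfl fun s _ => ?_
  rw [mapMat_apply, mul_ite, mul_one, mul_zero]

/-- Pushing forward preserves the total mass. [folklore] -/
theorem sum_vecMul_mapMat (x : α → R) (G : α → α) : ∑ s', (x ᵥ* mapMat R G) s' = ∑ s, x s := by
  simp_rw [vecMul_mapMat]
  exact Finset.sum_fiberwise_of_maps_to (fun _ _ => Finset.mem_univ _) _

/-- Composition of maps is multiplication of their matrices. [folklore] -/
theorem mapMat_mul_mapMat (G H : α → α) : mapMat R G * mapMat R H = mapMat R (H ∘ G) := by
  ext s s''
  rw [Matrix.mul_apply, mapMat_apply]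
  simp_rw [mapMat_apply, ite_mul, one_mul, zero_mul]
  rw [Finset.sum_ite_eq]
  simp

omit [Fintype α] in
/-- The matrix of the identity map. [folklore] -/
theorem mapMat_id : mapMat R (id : α → α) = 1 := by
  ext s s'
  rw [mapMat_apply, Matrix.one_apply]; rfl

omit [Fintype α] in
/-- `mapMat` has entries `0, 1`, so it is preserved by ring homomorphisms. [folklore] -/
theorem map_mapMat (φ : R →+* S) (G : α → α) : (mapMat R G).map φ = mapMat S G := by
  ext s s'
  rw [Matrix.map_apply, mapMat_apply, mapMat_apply]
  split_ifs <;> simp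

/-- Pushing forward along a constant map concentrates the mass. [folklore] -/
theorem vecMul_mapMat_const (x : α → R) {G : α → α} {s₀ : α} (hG : ∀ s, G s = s₀) :
    x ᵥ* mapMat R G = (∑ s, x s) • Pi.single s₀ (1 : R) := by
  funext s'
  rw [vecMul_mapMat, Pi.smul_apply, smul_eq_mul]
  by_cases h : s' = s₀
  · subst h
    rw [Pi.single_eq_same, mul_one]
    exact Finset.sum_congr (by ext s; simp [hG s]) fun _ _ => rfl
  · rw [Pi.single_eq_of_ne h, mul_zero]
    refine Finset.sum_eq_zero fun s hs => ?_
    exact absurd ((Finset.mem_filter.1 hs).2.symm.trans (hG s)) h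

/-- **The Baxterised factor with cleared denominators**: for the argument `u = N/D`,
`q N D · Ř(u) = (q² D² - N²)·1 - q (N² - D²)·e`. [cite: IkhlefPonsaing2012, Def. 3.2] -/
def RpMat (q N D : R) (G : α → α) : Matrix α α R :=
  (q ^ 2 * D ^ 2 - N ^ 2) • (1 : Matrix α α R) - (q * (N ^ 2 - D ^ 2)) • mapMat R G

/-- The row-sum identity of the cleared factor: `(q² D² - N²) - q (N² - D²) = q² N² - D²` at
`q² + q + 1 = 0`. [folklore] -/
theorem rA_sub_rB {q : R} (hq : q ^ 2 + q + 1 = 0) (N D : R) :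
    (q ^ 2 * D ^ 2 - N ^ 2) - q * (N ^ 2 - D ^ 2) = q ^ 2 * N ^ 2 - D ^ 2 := by
  linear_combination (D ^ 2 - N ^ 2) * hq

omit [Fintype α] in
/-- Ring homomorphisms map cleared factors to cleared factors. [folklore] -/
theorem map_RpMat (φ : R →+* S) (q N D : R) (G : α → α) :
    (RpMat q N D G).map φ = RpMat (φ q) (φ N) (φ D) G := by
  ext s s'
  simp only [RpMat, Matrix.map_apply, Matrix.sub_apply, Matrix.smul_apply, Matrix.one_apply, mapMat_apply,
    smul_eq_mul, map_sub, mul_ite, mul_one, mul_zero]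
  split_ifs <;> simp

/-- Total mass after a cleared factor. [folklore] -/
theorem sum_vecMul_RpMat {q : R} (hq : q ^ 2 + q + 1 = 0) (x : α → R) (N D : R) (G : α → α) :
    ∑ s', (x ᵥ* RpMat q N D G) s' = (q ^ 2 * N ^ 2 - D ^ 2) * ∑ s, x s := by
  have h1 : x ᵥ* RpMat q N D G =
      (q ^ 2 * D ^ 2 - N ^ 2) • x - (q * (N ^ 2 - D ^ 2)) • (x ᵥ* mapMat R G) := by
    rw [RpMat, vecMul_sub, vecMul_smul, vecMul_smul, vecMul_one]
  rw [h1]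
  simp only [Pi.sub_apply, Pi.smul_apply, smul_eq_mul, Finset.sum_sub_distrib, ← Finset.mul_sum,
    sum_vecMul_mapMat]
  rw [← sub_mul, rA_sub_rB hq]

end MapMatrices

section FieldFactors

open _root_.Matrix

variable {α : Type*} [Fintype α] [DecidableEq α] {F F' : Type*} [Field F] [Field F']

/-- **The Baxterised factor** `Ř(u) = ([q/u]·1 - [u]·e)/[q u]` for `u = N/D`, as a matrix acting on row
vectors (right kernel convention of this development). [cite: IkhlefPonsaing2012, Def. 3.2] -/
def RfMat (q N D : F) (G : α → α) : Matrix α α F :=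
  (q ^ 2 * N ^ 2 - D ^ 2)⁻¹ • RpMat q N D G

omit [Fintype α] in
/-- Field homomorphisms map factors to factors. [folklore] -/
theorem map_RfMat (φ : F →+* F') (q N D : F) (G : α → α) :
    (RfMat q N D G).map φ = RfMat (φ q) (φ N) (φ D) G := by
  have h : (RfMat q N D G).map φ = (φ (q ^ 2 * N ^ 2 - D ^ 2)⁻¹) • (RpMat q N D G).map φ := by
    ext s s'
    simp only [RfMat, Matrix.map_apply, Matrix.smul_apply, smul_eq_mul, map_mul, map_inv₀]
  rw [h, map_RpMat, RfMat]
  simp only [map_inv₀, map_sub, map_mul, map_pow]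

omit [Fintype α] in
/-- The factor only depends on the ratio `N/D`. [folklore] -/
theorem RfMat_scale (q : F) {t : F} (ht : t ≠ 0) (N D : F) (G : α → α) :
    RfMat q (t * N) (t * D) G = RfMat q N D G := by
  have ht2 : t ^ 2 ≠ 0 := pow_ne_zero 2 ht
  rw [RfMat, RfMat, RpMat, RpMat]
  have e1 : q ^ 2 * (t * N) ^ 2 - (t * D) ^ 2 = t ^ 2 * (q ^ 2 * N ^ 2 - D ^ 2) := by ring
  have e2 : q ^ 2 * (t * D) ^ 2 - (t * N) ^ 2 = t ^ 2 * (q ^ 2 * D ^ 2 - N ^ 2) := by ring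
  have e3 : q * ((t * N) ^ 2 - (t * D) ^ 2) = t ^ 2 * (q * (N ^ 2 - D ^ 2)) := by ring
  rw [e1, e2, e3, mul_smul, mul_smul, ← smul_sub, smul_smul,
    show (t ^ 2 * (q ^ 2 * N ^ 2 - D ^ 2))⁻¹ * t ^ 2 = (q ^ 2 * N ^ 2 - D ^ 2)⁻¹ from by
      rw [_root_.mul_inv_rev, mul_assoc, inv_mul_cancel₀ ht2, mul_one]]

/-- Total mass is preserved by a factor with nonvanishing denominator. [folklore] -/
theorem sum_vecMul_RfMat {q : F} (hq : q ^ 2 + q + 1 = 0) (x : α → F) {N D : F}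
    (hND : q ^ 2 * N ^ 2 - D ^ 2 ≠ 0) (G : α → α) : ∑ s', (x ᵥ* RfMat q N D G) s' = ∑ s, x s := by
  rw [RfMat, vecMul_smul]
  simp only [Pi.smul_apply, smul_eq_mul, ← Finset.mul_sum]
  rw [sum_vecMul_RpMat hq, ← mul_assoc, inv_mul_cancel₀ hND, one_mul]

/-- Total mass is preserved by a product of factors with nonvanishing denominators. [folklore] -/
theorem sum_vecMul_list_prod_RfMat {q : F} (hq : q ^ 2 + q + 1 = 0) (l : List (F × F × (α → α)))
    (hl : ∀ f ∈ l, q ^ 2 * f.1 ^ 2 - f.2.1 ^ 2 ≠ 0) (x : α → F) :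
    ∑ s', (x ᵥ* (l.map fun f => RfMat q f.1 f.2.1 f.2.2).prod) s' = ∑ s, x s := by
  induction l generalizing x with
  | nil => simp
  | cons f l ih =>
    rw [List.map_cons, List.prod_cons, ← Matrix.vecMul_vecMul,
      ih (fun g hg => hl g (List.mem_cons_of_mem _ hg)), sum_vecMul_RfMat hq x (hl f (by simp))]

end FieldFactors

/-! ### The exchange relations on the connectivity basis, in matrix form -/

section NCExchange

open _root_.Matrix MvPolynomial

variable {m : ℕ}

/-- The generator map at level `i ∈ [1, 2m]` on non-crossing states (`e_i`: join at odd levels,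
isolate at even levels); the identity outside the range. [cite: IkhlefPonsaing2012, §3.1] -/
def genMap (m : ℕ) (i : ℕ) : NCState (m + 1) → NCState (m + 1) :=
  if h : 1 ≤ i ∧ i ≤ 2 * m then tlConnFun m ⟨i - 1, by omega⟩ else id

/-- Odd levels join consecutive sites. [folklore] -/
theorem genMap_odd (j' : Fin m) :
    genMap m (2 * (j' : ℕ) + 1) = NCState.joinS (Fin.castSucc j') j'.succ (by simp) := by
  funext s
  apply Subtype.ext
  have h : 1 ≤ 2 * (j' : ℕ) + 1 ∧ 2 * (j' : ℕ) + 1 ≤ 2 * m := by omega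
  have hk : ((⟨2 * (j' : ℕ) + 1 - 1, by omega⟩ : Fin (2 * m)) : ℕ) % 2 = 0 := by
    simp only; omega
  rw [genMap, dif_pos h, tlConnFun_of_even m hk]
  have hh : halfIdx m ⟨2 * (j' : ℕ) + 1 - 1, by omega⟩ = j' := Fin.ext (by simp [halfIdx])
  simp only [NCState.joinS_val]
  rw [hh]

/-- Even levels isolate a site. [folklore] -/
theorem genMap_even (b0 : Fin m) : genMap m (2 * (b0 : ℕ) + 2) = NCState.isolS b0.succ := by
  have h : 1 ≤ 2 * (b0 : ℕ) + 2 ∧ 2 * (b0 : ℕ) + 2 ≤ 2 * m := by omega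
  have hk : ((⟨2 * (b0 : ℕ) + 2 - 1, by omega⟩ : Fin (2 * m)) : ℕ) % 2 = 1 := by
    simp only; omega
  rw [genMap, dif_pos h, tlConnFun_of_odd m hk]
  have hh : halfIdx m ⟨2 * (b0 : ℕ) + 2 - 1, by omega⟩ = b0 := Fin.ext (by simp [halfIdx]; omega)
  rw [hh]

/-- Entries of a row vector times a factor. [folklore] -/
theorem vecMul_RfMat_apply {α : Type*} [Fintype α] [DecidableEq α] {F : Type*} [Field F]
    (x : α → F) (q N D : F) (G : α → α) (s : α) :
    (x ᵥ* RfMat q N D G) s =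
      (q ^ 2 * N ^ 2 - D ^ 2)⁻¹ * ((q ^ 2 * D ^ 2 - N ^ 2) * x s - q * (N ^ 2 - D ^ 2) * (x ᵥ* mapMat F G) s) := by
  rw [RfMat, RpMat, vecMul_smul, Pi.smul_apply, smul_eq_mul, vecMul_sub, vecMul_smul, vecMul_smul, vecMul_one,
    Pi.sub_apply, Pi.smul_apply, Pi.smul_apply, smul_eq_mul, smul_eq_mul]

/-- **The exact exchange relation in matrix form on the connectivity basis**: if `ψ` (supported on the
physical sector) satisfies the exact exchange relation at level `i` with fibre map `g`, and the
`g`-fibres over the sector are the fibres of the state map `G`, then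
`σ_i v = v ᵥ* Ř_i(z_i/z_{i+1})` for `v = ψ ∘ cpOf`. [cite: IkhlefPonsaing2012, §3.4 (20)] -/
theorem ncExchange_matrix_of {q : ℂ} (hq : q ^ 2 + q + 1 = 0) {i : ℕ} {g : ColPattern m → ColPattern m}
    {ψ : ColPattern m → RapidityField ℂ} (hex : IsExactExchange q i g ψ)
    {G : NCState (m + 1) → NCState (m + 1)}
    (hfib : ∀ s, ipPush g ψ (cpOf s) = (ncVec ψ ᵥ* mapMat (RapidityField ℂ) G) s) (s : NCState (m + 1)) :
    genSwap ℂ i (ncVec ψ s) = (ncVec ψ ᵥ* RfMat (genC ℂ q) (genZ ℂ i) (genZ ℂ (i + 1)) G) s := by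
  have hq0 : q ≠ 0 := ne_zero_of_quad hq
  have hc0 : genC ℂ q ≠ 0 := toRF_ne_zero_of_eval (fun _ => 1) (by simp [hq0])
  have hzi := genZ_ne_zero (K₀ := ℂ) i
  have hzj := genZ_ne_zero (K₀ := ℂ) (i + 1)
  have hD : genC ℂ q * genZ ℂ i * genZ ℂ (i + 1) ≠ 0 := mul_ne_zero (mul_ne_zero hc0 hzi) hzj
  -- the denominator `q² z_i² - z_{i+1}²` is not zero
  have hC : genC ℂ q ^ 2 * genZ ℂ i ^ 2 - genZ ℂ (i + 1) ^ 2 ≠ 0 := by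
    have : genC ℂ q ^ 2 * genZ ℂ i ^ 2 - genZ ℂ (i + 1) ^ 2 = toRF ℂ (C (q ^ 2) * X i ^ 2 - X (i + 1) ^ 2) := by
      simp only [map_sub, map_mul, map_pow]; rfl
    rw [this]
    refine toRF_ne_zero_of_eval (fun n => if n = i then 1 else 0) ?_
    simp [hq0]
  have h := hex (cpOf s)
  rw [hfib s] at h
  change qbr (genC ℂ q * genZ ℂ (i + 1) / genZ ℂ i) * ncVec ψ s - _ = _ * genSwap ℂ i (ncVec ψ s) at h
  -- clear the denominators `q z_i z_{i+1}`
  have h' := congrArg (· * (genC ℂ q * genZ ℂ i * genZ ℂ (i + 1))) h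
  simp only [sub_mul] at h'
  rw [mul_right_comm, qbr_mul_clear₁ hq0, mul_right_comm, qbr_mul_clear₂, mul_right_comm, qbr_mul_clear₃ hq0] at h'
  have e1 : toRF ℂ (C (q ^ 2) * X (i + 1) ^ 2 - X i ^ 2) = genC ℂ q ^ 2 * genZ ℂ (i + 1) ^ 2 - genZ ℂ i ^ 2 := by
    simp only [map_sub, map_mul, map_pow]; rfl
  have e2 : toRF ℂ (C q * (X i ^ 2 - X (i + 1) ^ 2)) = genC ℂ q * (genZ ℂ i ^ 2 - genZ ℂ (i + 1) ^ 2) := by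
    simp only [map_sub, map_mul, map_pow]; rfl
  have e3 : toRF ℂ (C (q ^ 2) * X i ^ 2 - X (i + 1) ^ 2) = genC ℂ q ^ 2 * genZ ℂ i ^ 2 - genZ ℂ (i + 1) ^ 2 := by
    simp only [map_sub, map_mul, map_pow]; rfl
  rw [e1, e2, e3] at h'
  rw [vecMul_RfMat_apply, h', ← mul_assoc, inv_mul_cancel₀ hC, one_mul]

/-- **The exact exchange relations of a solution supported on the physical sector, in matrix form**
(both parities, generator map `genMap`). [cite: IkhlefPonsaing2012, §3.4 (20)] -/
theorem ncExchange_matrix {q : ℂ} (hq : q ^ 2 + q + 1 = 0) {ψ : ColPattern m → RapidityField ℂ}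
    (hsupp : ∀ Q, ψ Q ≠ 0 → IsValid 0 Q ∧ IsPlanar Q ∧ lump Q = Q)
    (hodd : ∀ j' : Fin m, IsExactExchange q (2 * (j' : ℕ) + 1) (cpJoin (Fin.castSucc j') j'.succ) ψ)
    (heven : ∀ b0 : Fin m, IsExactExchange q (2 * (b0 : ℕ) + 2) (cpIsolate b0.succ) ψ)
    {i : ℕ} (hi1 : 1 ≤ i) (hi2 : i ≤ 2 * m) (s : NCState (m + 1)) :
    genSwap ℂ i (ncVec ψ s) = (ncVec ψ ᵥ* RfMat (genC ℂ q) (genZ ℂ i) (genZ ℂ (i + 1)) (genMap m i)) s := by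
  obtain ⟨k, hk | hk⟩ := Nat.even_or_odd' i
  · -- even level `i = 2k = 2 b0 + 2`
    have hb : k - 1 < m := by omega
    have hidx : 2 * ((⟨k - 1, hb⟩ : Fin m) : ℕ) + 2 = i := by simp only; omega
    have h := ncExchange_matrix_of hq (heven ⟨k - 1, hb⟩) (G := NCState.isolS (⟨k - 1, hb⟩ : Fin m).succ)
      (fun s => by
        rw [vecMul_mapMat]
        exact sum_fiber_cpIsolate_eq hsupp (Fin.succ_ne_zero _) s) s
    rw [hidx] at h
    rw [h, ← hidx, genMap_even]
  · -- odd level `i = 2k + 1`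
    have hb : k < m := by omega
    have hidx : 2 * ((⟨k, hb⟩ : Fin m) : ℕ) + 1 = i := by simp only; omega
    have h := ncExchange_matrix_of hq (hodd ⟨k, hb⟩)
      (G := NCState.joinS (Fin.castSucc (⟨k, hb⟩ : Fin m)) (⟨k, hb⟩ : Fin m).succ (by simp))
      (fun s => by
        rw [vecMul_mapMat]
        exact sum_fiber_cpJoin_eq hsupp _ _ (by simp) s) s
    rw [hidx] at h
    rw [h, ← hidx, genMap_odd]

end NCExchange

/-! ### The cocycle along the word `σ_1 ⋯ σ_{2m} ι_L σ_{2m} ⋯ σ_1 ι_1` -/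

section Cocycle

open _root_.Matrix MvPolynomial

variable {m : ℕ}

/-- The Baxterised factor `Ř_i(N/D)` on the connectivity basis over the rapidity field.
[cite: IkhlefPonsaing2012, Def. 3.2] -/
noncomputable def ncR (m : ℕ) (q : ℂ) (i : ℕ) (N D : RapidityField ℂ) :
    Matrix (NCState (m + 1)) (NCState (m + 1)) (RapidityField ℂ) :=
  RfMat (genC ℂ q) N D (genMap m i)

/-- Automorphisms fixing `q` transport the factors. [folklore] -/
theorem map_ncR {φ : RapidityField ℂ →+* RapidityField ℂ} {q : ℂ} (hφ : φ (genC ℂ q) = genC ℂ q) (i : ℕ)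
    (N D : RapidityField ℂ) : (ncR m q i N D).map φ = ncR m q i (φ N) (φ D) := by
  rw [ncR, map_RfMat, hφ, ncR]

/-- `genSwap` on the generators, as an `if`. [folklore] -/
theorem genSwap_genZ_eq (i n : ℕ) :
    genSwap ℂ i (genZ ℂ n) = if n = i then genZ ℂ (i + 1) else if n = i + 1 then genZ ℂ i else genZ ℂ n := by
  rw [genSwap_genZ]; rfl

/-- `genInv` on the generators, as an `if`. [folklore] -/
theorem genInv_genZ_eq (k n : ℕ) : genInv ℂ k (genZ ℂ n) = if n = k then (genZ ℂ k)⁻¹ else genZ ℂ n := by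
  rw [genInv_genZ, Function.update_apply]

/-- The relation "`φ v = t · (v ᵥ* B)`" between a ring endomorphism applied entrywise to a vector and a
matrix acting on it. [folklore] -/
def CocRel (v : NCState (m + 1) → RapidityField ℂ) (φ : RapidityField ℂ →+* RapidityField ℂ)
    (B : Matrix (NCState (m + 1)) (NCState (m + 1)) (RapidityField ℂ)) (t : RapidityField ℂ) : Prop :=
  ∀ s, φ (v s) = t * (v ᵥ* B) s

/-- **Base of the cocycle**: the bottom reflection. [cite: IkhlefPonsaing2012, (22)] -/
theorem cocRel_base {v : NCState (m + 1) → RapidityField ℂ} {a : ℤ}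
    (hbot : ∀ s, genInv ℂ 1 (v s) = genZ ℂ 1 ^ (2 * a) * v s) : CocRel v (genInv ℂ 1) 1 (genZ ℂ 1 ^ (2 * a)) := by
  intro s; rw [vecMul_one]; exact hbot s

/-- **Swap step of the cocycle**: composing with `σ_k` multiplies the matrix by `Ř_k` on the left and
transports the old matrix. [cite: IkhlefPonsaing2012, (20)] -/
theorem cocRel_swap {q : ℂ} {v : NCState (m + 1) → RapidityField ℂ} {φ : RapidityField ℂ →+* RapidityField ℂ}
    {B : Matrix (NCState (m + 1)) (NCState (m + 1)) (RapidityField ℂ)} {t : RapidityField ℂ}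
    (h : CocRel v φ B t) {k : ℕ}
    (hexk : ∀ s, genSwap ℂ k (v s) = (v ᵥ* ncR m q k (genZ ℂ k) (genZ ℂ (k + 1))) s) :
    CocRel v ((genSwap ℂ k).toRingHom.comp φ)
      (ncR m q k (genZ ℂ k) (genZ ℂ (k + 1)) * B.map (genSwap ℂ k)) (genSwap ℂ k t) := by
  intro s
  rw [RingHom.comp_apply, RingEquiv.toRingHom_eq_coe, RingHom.coe_coe, h s, map_mul, ← Matrix.vecMul_vecMul]
  congr 1
  rw [vecMul, dotProduct, map_sum, vecMul, dotProduct]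
  refine Finset.sum_congr rfl fun s' _ => ?_
  rw [map_mul, hexk s', Matrix.map_apply]

/-- **Inversion step of the cocycle**: composing with `ι_L` transports the matrix and multiplies the
scalar by the twist. [cite: IkhlefPonsaing2012, (21)] -/
theorem cocRel_inv {v : NCState (m + 1) → RapidityField ℂ} {φ : RapidityField ℂ →+* RapidityField ℂ}
    {B : Matrix (NCState (m + 1)) (NCState (m + 1)) (RapidityField ℂ)} {t : RapidityField ℂ}
    (h : CocRel v φ B t) {L : ℕ} {a : ℤ} (htop : ∀ s, genInv ℂ L (v s) = genZ ℂ L ^ (2 * a) * v s) :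
    CocRel v ((genInv ℂ L).comp φ) (B.map (genInv ℂ L)) (genZ ℂ L ^ (2 * a) * genInv ℂ L t) := by
  intro s
  rw [RingHom.comp_apply, h s, map_mul, vecMul, dotProduct, map_sum, vecMul, dotProduct, Finset.mul_sum,
    Finset.mul_sum]
  refine Finset.sum_congr rfl fun s' _ => ?_
  rw [map_mul, htop s', Matrix.map_apply]
  ring

/-- The matrix after the up phase `σ_k ⋯ σ_1 ι_1`. [folklore] -/
noncomputable def upB (m : ℕ) (q : ℂ) : ℕ → Matrix (NCState (m + 1)) (NCState (m + 1)) (RapidityField ℂ)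
  | 0 => 1
  | k + 1 => ncR m q (k + 1) (genZ ℂ (k + 1)) (genZ ℂ (k + 2)) * (upB m q k).map (genSwap ℂ (k + 1))

/-- The automorphism `σ_k ∘ ⋯ ∘ σ_1 ∘ ι_1`. [folklore] -/
noncomputable def upHom : ℕ → (RapidityField ℂ →+* RapidityField ℂ)
  | 0 => genInv ℂ 1
  | k + 1 => (genSwap ℂ (k + 1)).toRingHom.comp (upHom k)

/-- The matrix after the down phase `σ_{2m-j+1} ⋯ σ_{2m} ι_L (up phase)`. [folklore] -/
noncomputable def downB (m : ℕ) (q : ℂ) : ℕ → Matrix (NCState (m + 1)) (NCState (m + 1)) (RapidityField ℂ)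
  | 0 => (upB m q (2 * m)).map (genInv ℂ (2 * m + 1))
  | j + 1 => ncR m q (2 * m - j) (genZ ℂ (2 * m - j)) (genZ ℂ (2 * m - j + 1)) * (downB m q j).map (genSwap ℂ (2 * m - j))

/-- The automorphism of the down phase. [folklore] -/
noncomputable def downHom (m : ℕ) : ℕ → (RapidityField ℂ →+* RapidityField ℂ)
  | 0 => (genInv ℂ (2 * m + 1)).comp (upHom (2 * m))
  | j + 1 => (genSwap ℂ (2 * m - j)).toRingHom.comp (downHom m j)

/-- **The cocycle matrix `Y`** of the word `σ_1 ⋯ σ_{2m} ι_L σ_{2m} ⋯ σ_1 ι_1` (the translation of `z_1`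
in the affine Weyl group `C̃_L`, the identity on the rapidity field). [cite: IkhlefPonsaing2012, §3.4] -/
noncomputable def cocycleY (m : ℕ) (q : ℂ) : Matrix (NCState (m + 1)) (NCState (m + 1)) (RapidityField ℂ) :=
  downB m q (2 * m)

section Relations

variable {q : ℂ} {v : NCState (m + 1) → RapidityField ℂ} {a : ℤ}

/-- The up phase. [cite: IkhlefPonsaing2012, (20)–(22)] -/
theorem cocRel_up
    (hex : ∀ i, 1 ≤ i → i ≤ 2 * m → ∀ s, genSwap ℂ i (v s) = (v ᵥ* ncR m q i (genZ ℂ i) (genZ ℂ (i + 1))) s)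
    (hbot : ∀ s, genInv ℂ 1 (v s) = genZ ℂ 1 ^ (2 * a) * v s) {k : ℕ} (hk : k ≤ 2 * m) :
    CocRel v (upHom k) (upB m q k) (genZ ℂ (k + 1) ^ (2 * a)) := by
  induction k with
  | zero => exact cocRel_base hbot
  | succ k ih =>
    have h := cocRel_swap (ih (by omega)) (hex (k + 1) (by omega) (by omega))
    have ht : genSwap ℂ (k + 1) (genZ ℂ (k + 1) ^ (2 * a)) = genZ ℂ (k + 1 + 1) ^ (2 * a) := by
      rw [map_zpow₀, genSwap_genZ_eq, if_pos rfl]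
    rw [ht] at h
    exact h

/-- The inversion at the top. [cite: IkhlefPonsaing2012, (20)–(22)] -/
theorem cocRel_mid
    (hex : ∀ i, 1 ≤ i → i ≤ 2 * m → ∀ s, genSwap ℂ i (v s) = (v ᵥ* ncR m q i (genZ ℂ i) (genZ ℂ (i + 1))) s)
    (hbot : ∀ s, genInv ℂ 1 (v s) = genZ ℂ 1 ^ (2 * a) * v s)
    (htop : ∀ s, genInv ℂ (2 * m + 1) (v s) = genZ ℂ (2 * m + 1) ^ (2 * a) * v s) :
    CocRel v (downHom m 0) (downB m q 0) 1 := by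
  have h := cocRel_inv (cocRel_up hex hbot le_rfl) htop
  have ht : genZ ℂ (2 * m + 1) ^ (2 * a) * genInv ℂ (2 * m + 1) (genZ ℂ (2 * m + 1) ^ (2 * a)) = 1 := by
    rw [map_zpow₀, genInv_genZ_eq, if_pos rfl, _root_.inv_zpow', ← zpow_add₀ (genZ_ne_zero _), add_neg_cancel, zpow_zero]
  rw [ht] at h
  exact h

/-- The down phase. [cite: IkhlefPonsaing2012, (20)–(22)] -/
theorem cocRel_down
    (hex : ∀ i, 1 ≤ i → i ≤ 2 * m → ∀ s, genSwap ℂ i (v s) = (v ᵥ* ncR m q i (genZ ℂ i) (genZ ℂ (i + 1))) s)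
    (hbot : ∀ s, genInv ℂ 1 (v s) = genZ ℂ 1 ^ (2 * a) * v s)
    (htop : ∀ s, genInv ℂ (2 * m + 1) (v s) = genZ ℂ (2 * m + 1) ^ (2 * a) * v s) {j : ℕ} (hj : j ≤ 2 * m) :
    CocRel v (downHom m j) (downB m q j) 1 := by
  induction j with
  | zero => exact cocRel_mid hex hbot htop
  | succ j ih =>
    have h := cocRel_swap (ih (by omega)) (hex (2 * m - j) (by omega) (by omega))
    rw [map_one] at h
    exact h

end Relations

/-! #### The word is the identity automorphism -/

/-- `upHom` fixes the constants. [folklore] -/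
theorem upHom_genC (k : ℕ) (c : ℂ) : upHom k (genC ℂ c) = genC ℂ c := by
  induction k with
  | zero => exact genInv_genC 1 c
  | succ k ih =>
    show genSwap ℂ (k + 1) (upHom k (genC ℂ c)) = genC ℂ c
    rw [ih, genSwap_genC]

/-- `downHom` fixes the constants. [folklore] -/
theorem downHom_genC (j : ℕ) (c : ℂ) : downHom m j (genC ℂ c) = genC ℂ c := by
  induction j with
  | zero =>
    show genInv ℂ (2 * m + 1) (upHom (2 * m) (genC ℂ c)) = genC ℂ c
    rw [upHom_genC, genInv_genC]
  | succ j ih =>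
    show genSwap ℂ (2 * m - j) (downHom m j (genC ℂ c)) = genC ℂ c
    rw [ih, genSwap_genC]

/-- `upHom k` on the generators: `z_1 ↦ z_{k+1}⁻¹`, `z_n ↦ z_{n-1}` for `2 ≤ n ≤ k+1`, identity elsewhere.
[folklore] -/
theorem upHom_genZ (k n : ℕ) :
    upHom k (genZ ℂ n) =
      if n = 1 then (genZ ℂ (k + 1))⁻¹ else if 2 ≤ n ∧ n ≤ k + 1 then genZ ℂ (n - 1) else genZ ℂ n := by
  induction k generalizing n with
  | zero =>
    show genInv ℂ 1 (genZ ℂ n) = _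
    rw [genInv_genZ_eq]
    by_cases h1 : n = 1
    · simp [h1]
    · rw [if_neg h1, if_neg h1, if_neg (by omega)]
  | succ k ih =>
    show genSwap ℂ (k + 1) (upHom k (genZ ℂ n)) = _
    rw [ih]
    by_cases h1 : n = 1
    · rw [if_pos h1, if_pos h1, map_inv₀, genSwap_genZ_eq, if_pos rfl]
    rw [if_neg h1, if_neg h1]
    by_cases h2 : 2 ≤ n ∧ n ≤ k + 1
    · rw [if_pos h2, if_pos (by omega), genSwap_genZ_eq, if_neg (by omega), if_neg (by omega)]
    rw [if_neg h2]
    by_cases h3 : n = k + 2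
    · rw [if_pos (by omega), genSwap_genZ_eq, if_neg (by omega), if_pos (by omega)]
      congr 1; omega
    · rw [if_neg (by omega), genSwap_genZ_eq, if_neg (by omega), if_neg (by omega)]

/-- `downHom j` on the generators: `z_1 ↦ z_{L-j}`, `z_n ↦ z_{n-1}` for `2 ≤ n ≤ L-j`, identity elsewhere
(`L = 2m+1`, `j ≤ 2m`). [folklore] -/
theorem downHom_genZ {j : ℕ} (hj : j ≤ 2 * m) (n : ℕ) :
    downHom m j (genZ ℂ n) =
      if n = 1 then genZ ℂ (2 * m + 1 - j) else if 2 ≤ n ∧ n ≤ 2 * m + 1 - j then genZ ℂ (n - 1) else genZ ℂ n := by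
  induction j generalizing n with
  | zero =>
    show genInv ℂ (2 * m + 1) (upHom (2 * m) (genZ ℂ n)) = _
    rw [upHom_genZ]
    by_cases h1 : n = 1
    · rw [if_pos h1, if_pos h1, map_inv₀, genInv_genZ_eq, if_pos rfl, inv_inv, Nat.sub_zero]
    rw [if_neg h1, if_neg h1]
    by_cases h2 : 2 ≤ n ∧ n ≤ 2 * m + 1
    · rw [if_pos h2, if_pos (by omega), genInv_genZ_eq, if_neg (by omega)]
    · rw [if_neg h2, if_neg (by omega), genInv_genZ_eq, if_neg (by omega)]
  | succ j ih =>
    show genSwap ℂ (2 * m - j) (downHom m j (genZ ℂ n)) = _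
    rw [ih (by omega)]
    by_cases h1 : n = 1
    · rw [if_pos h1, if_pos h1, genSwap_genZ_eq, if_neg (by omega), if_pos (by omega)]
      congr 1; omega
    rw [if_neg h1, if_neg h1]
    by_cases h2 : 2 ≤ n ∧ n ≤ 2 * m + 1 - (j + 1)
    · rw [if_pos (by omega), if_pos h2, genSwap_genZ_eq, if_neg (by omega), if_neg (by omega)]
    rw [if_neg h2]
    by_cases h3 : n = 2 * m + 1 - j
    · rw [if_pos (by omega), genSwap_genZ_eq, if_pos (by omega)]
      congr 1; omega
    · rw [if_neg (by omega), genSwap_genZ_eq, if_neg (by omega), if_neg (by omega)]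

/-- **The word `σ_1 ⋯ σ_{2m} ι_L σ_{2m} ⋯ σ_1 ι_1` is the identity automorphism of the rapidity field**
(the translation of `z_1` acts trivially). [folklore] -/
theorem downHom_two_mul_eq_id : downHom m (2 * m) = RingHom.id _ := by
  refine rapidityField_ringHom_ext (fun c => ?_) (fun n => ?_)
  · rw [downHom_genC]; rfl
  · rw [downHom_genZ le_rfl, RingHom.id_apply]
    by_cases h1 : n = 1
    · rw [if_pos h1, h1]; congr 1; omega
    · rw [if_neg h1, if_neg (by omega)]

/-- **Every solution of the exact system on the connectivity basis is fixed by the cocycle matrix**: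
`v = v ᵥ* Y`. [cite: IkhlefPonsaing2012, §3.4 (20)–(22)] -/
theorem ncSolution_vecMul_cocycleY {q : ℂ} {v : NCState (m + 1) → RapidityField ℂ} {a : ℤ}
    (hex : ∀ i, 1 ≤ i → i ≤ 2 * m → ∀ s, genSwap ℂ i (v s) = (v ᵥ* ncR m q i (genZ ℂ i) (genZ ℂ (i + 1))) s)
    (hbot : ∀ s, genInv ℂ 1 (v s) = genZ ℂ 1 ^ (2 * a) * v s)
    (htop : ∀ s, genInv ℂ (2 * m + 1) (v s) = genZ ℂ (2 * m + 1) ^ (2 * a) * v s) :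
    v ᵥ* (cocycleY m q - 1) = 0 := by
  have h := cocRel_down hex hbot htop (le_refl (2 * m))
  rw [downHom_two_mul_eq_id] at h
  funext s
  rw [vecMul_sub, vecMul_one, Pi.sub_apply, Pi.zero_apply, sub_eq_zero, cocycleY]
  have := h s
  rw [RingHom.id_apply, one_mul] at this
  exact this.symm

end Cocycle

/-! ### The cocycle matrix as an explicit product of factors -/

section ClosedForm

open _root_.Matrix MvPolynomial

variable {m : ℕ}

/-- A factor descriptor `(i, N, D)` stands for `Ř_i(N/D)` with polynomial `N, D`. [folklore] -/
abbrev FDesc : Type := ℕ × MvPolynomial ℕ ℂ × MvPolynomial ℕ ℂ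

/-- The matrix of a descriptor. [folklore] -/
noncomputable def dMat (m : ℕ) (q : ℂ) (f : FDesc) : Matrix (NCState (m + 1)) (NCState (m + 1)) (RapidityField ℂ) :=
  ncR m q f.1 (toRF ℂ f.2.1) (toRF ℂ f.2.2)

/-- The ordered product of the matrices of a list of descriptors. [folklore] -/
noncomputable def prodD (m : ℕ) (q : ℂ) (l : List FDesc) : Matrix (NCState (m + 1)) (NCState (m + 1)) (RapidityField ℂ) :=
  (l.map (dMat m q)).prod

/-- Renaming a descriptor by the transposition `(k, k+1)`. [folklore] -/
noncomputable def dSwap (k : ℕ) (f : FDesc) : FDesc :=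
  (f.1, rename (Equiv.swap k (k + 1)) f.2.1, rename (Equiv.swap k (k + 1)) f.2.2)

/-- `prodD` of a cons. [folklore] -/
theorem prodD_cons (q : ℂ) (f : FDesc) (l : List FDesc) : prodD m q (f :: l) = dMat m q f * prodD m q l := by
  rw [prodD, List.map_cons, List.prod_cons, prodD]

/-- `prodD` of an append. [folklore] -/
theorem prodD_append (q : ℂ) (l l' : List FDesc) : prodD m q (l ++ l') = prodD m q l * prodD m q l' := by
  rw [prodD, List.map_append, List.prod_append, prodD, prodD]

/-- Transporting a product of descriptor matrices along an endomorphism fixing `q`. [folklore] -/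
theorem map_prodD {φ : RapidityField ℂ →+* RapidityField ℂ} {q : ℂ} (hφ : φ (genC ℂ q) = genC ℂ q) (l : List FDesc) :
    (prodD m q l).map φ = (l.map fun f => ncR m q f.1 (φ (toRF ℂ f.2.1)) (φ (toRF ℂ f.2.2))).prod := by
  induction l with
  | nil => rw [prodD, List.map_nil, List.map_nil, List.prod_nil, Matrix.map_one _ (map_zero φ) (map_one φ)]
  | cons f l ih =>
    rw [prodD_cons, Matrix.map_mul, ih, List.map_cons, List.prod_cons, dMat, map_ncR hφ]

/-- Transport along `σ_k` renames the descriptors. [folklore] -/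
theorem map_prodD_genSwap (q : ℂ) (k : ℕ) (l : List FDesc) :
    (prodD m q l).map (genSwap ℂ k) = prodD m q (l.map (dSwap k)) := by
  have h := map_prodD (m := m) (φ := (genSwap ℂ k).toRingHom) (q := q) (by simp [genSwap_genC]) l
  simp only [RingEquiv.toRingHom_eq_coe, RingHom.coe_coe, genSwap_toRF] at h
  rw [h, prodD, List.map_map]
  rfl

/-- The descriptors of the up phase: `(i, X_i, X_{k+1})` for `i = k, k-1, …, 1`. [folklore] -/
noncomputable def upList (k : ℕ) : List FDesc :=
  (List.range k).reverse.map fun i => (i + 1, X (i + 1), X (k + 1))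

/-- **Closed form of the up phase.** [folklore] -/
theorem upB_eq_prodD (q : ℂ) (k : ℕ) : upB m q k = prodD m q (upList k) := by
  induction k with
  | zero => rw [upB, upList, List.range_zero, List.reverse_nil, List.map_nil, prodD, List.map_nil, List.prod_nil]
  | succ k ih =>
    rw [upB, ih, map_prodD_genSwap]
    have hl : (upList k).map (dSwap (k + 1)) = (List.range k).reverse.map fun i => (i + 1, X (i + 1), X (k + 2)) := by
      rw [upList, List.map_map]
      refine List.map_congr_left fun i hi => ?_
      have hik : i < k := List.mem_range.1 (List.mem_reverse.1 hi)
      simp only [Function.comp_apply, dSwap, rename_X, Equiv.swap_apply_of_ne_of_ne (show i + 1 ≠ k + 1 by omega)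
        (show i + 1 ≠ k + 1 + 1 by omega), Equiv.swap_apply_left]
    rw [hl, show upList (k + 1) = ((k + 1, X (k + 1), X (k + 2)) : FDesc) ::
        (List.range k).reverse.map (fun i => (i + 1, X (i + 1), X (k + 2))) from by
      rw [upList, List.range_succ, List.reverse_append, List.reverse_singleton, List.singleton_append, List.map_cons],
      prodD_cons]
    rfl

/-- The descriptors after the inversion at the top: `(i, X_i X_L, 1)` for `i = 2m, …, 1`. [folklore] -/
noncomputable def midList (m : ℕ) : List FDesc :=
  (List.range (2 * m)).reverse.map fun i => (i + 1, X (i + 1) * X (2 * m + 1), 1)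

/-- **Closed form after the inversion at the top.** [folklore] -/
theorem downB_zero_eq_prodD (q : ℂ) : downB m q 0 = prodD m q (midList m) := by
  rw [downB, upB_eq_prodD, map_prodD (φ := genInv ℂ (2 * m + 1)) (genInv_genC _ _), midList, upList, List.map_map,
    prodD, List.map_map]
  congr 1
  refine List.map_congr_left fun i hi => ?_
  have hi' : i < 2 * m := List.mem_range.1 (List.mem_reverse.1 hi)
  simp only [Function.comp_apply, dMat]
  change ncR m q (i + 1) (genInv ℂ (2 * m + 1) (genZ ℂ (i + 1))) (genInv ℂ (2 * m + 1) (genZ ℂ (2 * m + 1))) =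
    ncR m q (i + 1) (toRF ℂ (X (i + 1) * X (2 * m + 1))) (toRF ℂ 1)
  rw [genInv_genZ_eq, if_neg (by omega), genInv_genZ_eq, if_pos rfl, map_mul, map_one]
  change _ = ncR m q (i + 1) (genZ ℂ (i + 1) * genZ ℂ (2 * m + 1)) 1
  rw [ncR, ncR, ← RfMat_scale (genC ℂ q) (genZ_ne_zero (2 * m + 1)), mul_inv_cancel₀ (genZ_ne_zero _), mul_comm]

/-- The ratio descriptors of the down phase after `j` swaps: `(L-j+t, X_{L-j}, X_{L-j+t+1})`, `t < j`.
[folklore] -/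
noncomputable def ratioList (m j : ℕ) : List FDesc :=
  (List.range j).map fun t => (2 * m + 1 - j + t, X (2 * m + 1 - j), X (2 * m + 1 - j + t + 1))

/-- The product descriptors of the down phase after `j` swaps (the renamed `midList`). [folklore] -/
noncomputable def prodList (m : ℕ) : ℕ → List FDesc
  | 0 => midList m
  | j + 1 => (prodList m j).map (dSwap (2 * m - j))

/-- **Closed form of the down phase.** [folklore] -/
theorem downB_eq_prodD (q : ℂ) {j : ℕ} (hj : j ≤ 2 * m) :
    downB m q j = prodD m q (ratioList m j ++ prodList m j) := by
  induction j with
  | zero => rw [downB_zero_eq_prodD, ratioList, List.range_zero, List.map_nil, List.nil_append, prodList]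
  | succ j ih =>
    rw [downB, ih (by omega), map_prodD_genSwap, List.map_append, prodD_append, ← Matrix.mul_assoc, ← prodList,
      prodD_append]
    congr 1
    have hl : (ratioList m j).map (dSwap (2 * m - j)) =
        (List.range j).map fun t => (2 * m - j + t + 1, X (2 * m - j), X (2 * m - j + t + 2)) := by
      rw [ratioList, List.map_map]
      refine List.map_congr_left fun t ht => ?_
      have htj : t < j := List.mem_range.1 ht
      simp only [Function.comp_apply, dSwap, rename_X]
      rw [show 2 * m + 1 - j = 2 * m - j + 1 by omega, Equiv.swap_apply_right,
        Equiv.swap_apply_of_ne_of_ne (show 2 * m - j + 1 + t + 1 ≠ 2 * m - j by omega)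
          (show 2 * m - j + 1 + t + 1 ≠ 2 * m - j + 1 by omega)]
      refine Prod.ext (by simp only; omega) (Prod.ext rfl ?_)
      simp only
      congr 1; omega
    rw [hl, show ratioList m (j + 1) = ((2 * m - j, X (2 * m - j), X (2 * m - j + 1)) : FDesc) ::
        (List.range j).map (fun t => (2 * m - j + t + 1, X (2 * m - j), X (2 * m - j + t + 2))) from by
      rw [ratioList, List.range_succ_eq_map, List.map_cons, List.map_map]
      refine congrArg₂ _ ?_ (List.map_congr_left fun t _ => ?_)
      · refine Prod.ext (by simp only; omega) (Prod.ext ?_ ?_) <;> simp only <;> congr 1 <;> omega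
      · simp only [Function.comp_apply]
        refine Prod.ext (by simp only; omega) (Prod.ext ?_ ?_) <;> simp only <;> congr 1 <;> omega,
      prodD_cons]
    rfl

/-- **The cocycle matrix is the product of the `2m` ratio factors `Ř_i(X_1/X_{i+1})`, `i = 1, …, 2m`,
followed by the `2m` product factors.** [folklore] -/
theorem cocycleY_eq_prodD (q : ℂ) :
    cocycleY m q = prodD m q (((List.range (2 * m)).map fun t => ((t + 1, X 1, X (t + 2)) : FDesc)) ++ prodList m (2 * m)) := by
  rw [cocycleY, downB_eq_prodD q le_rfl, ratioList]
  congr 3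
  funext t
  refine Prod.ext (by simp only; omega) (Prod.ext ?_ ?_) <;> simp only <;> congr 1 <;> omega

/-- The product descriptors are `(i, X_a X_b, 1)` with `a ≠ b` in `[1, L]`. [folklore] -/
def GoodP (L : ℕ) (f : FDesc) : Prop :=
  ∃ a b : ℕ, a ≠ b ∧ 1 ≤ a ∧ a ≤ L ∧ 1 ≤ b ∧ b ≤ L ∧ f.2.1 = X a * X b ∧ f.2.2 = 1

/-- Renaming by a transposition inside `[1, L]` preserves good product descriptors. [folklore] -/
theorem GoodP.dSwap {L : ℕ} {f : FDesc} (hf : GoodP L f) {k : ℕ} (hk1 : 1 ≤ k) (hk2 : k + 1 ≤ L) :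
    GoodP L (dSwap k f) := by
  obtain ⟨a, b, hab, ha1, ha2, hb1, hb2, hN, hD⟩ := hf
  refine ⟨Equiv.swap k (k + 1) a, Equiv.swap k (k + 1) b, ?_, ?_, ?_, ?_, ?_, ?_, ?_⟩
  · exact fun h => hab ((Equiv.swap k (k + 1)).injective h)
  · rw [Equiv.swap_apply_def]; split_ifs <;> omega
  · rw [Equiv.swap_apply_def]; split_ifs <;> omega
  · rw [Equiv.swap_apply_def]; split_ifs <;> omega
  · rw [Equiv.swap_apply_def]; split_ifs <;> omega
  · show rename _ f.2.1 = _
    rw [hN, map_mul, rename_X, rename_X]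
  · show rename _ f.2.2 = _
    rw [hD, map_one]

/-- All product descriptors of the down phase are good. [folklore] -/
theorem goodP_prodList {j : ℕ} (hj : j ≤ 2 * m) : ∀ f ∈ prodList m j, GoodP (2 * m + 1) f := by
  induction j with
  | zero =>
    intro f hf
    rw [prodList, midList] at hf
    obtain ⟨i, hi, rfl⟩ := List.mem_map.1 hf
    have hi' : i < 2 * m := List.mem_range.1 (List.mem_reverse.1 hi)
    exact ⟨i + 1, 2 * m + 1, by omega, by omega, by omega, by omega, le_rfl, rfl, rfl⟩
  | succ j ih =>
    intro f hf
    rw [prodList] at hf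
    obtain ⟨g, hg, rfl⟩ := List.mem_map.1 hf
    exact (ih (by omega) g hg).dSwap (by omega) (by omega)

end ClosedForm

/-! ### Evaluation at the special point and the rank of `Y - 1` -/

section SpecialPoint

open _root_.Matrix MvPolynomial

variable {m : ℕ}

/-- Composite of a list of maps, applied left to right. [folklore] -/
def compList {α : Type*} (l : List (α → α)) : α → α := fun s => l.foldl (fun s g => g s) s

/-- A product of map matrices is the map matrix of the composite. [folklore] -/
theorem prod_map_mapMat {α : Type*} [Fintype α] [DecidableEq α] {R : Type*} [CommRing R] (l : List (α → α)) :
    (l.map (mapMat R)).prod = mapMat R (compList l) := by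
  induction l with
  | nil => rw [List.map_nil, List.prod_nil, ← mapMat_id]; rfl
  | cons g l ih =>
    rw [List.map_cons, List.prod_cons, ih, mapMat_mul_mapMat]
    rfl

/-- Composite of an append. [folklore] -/
theorem compList_append {α : Type*} (l l' : List (α → α)) (s : α) :
    compList (l ++ l') s = compList l' (compList l s) := by
  simp [compList, List.foldl_append]

/-- The one-block state (all sites connected). [folklore] -/
def topState (n : ℕ) : NCState n := ⟨fun _ _ => true, ⟨fun _ => rfl, fun _ _ _ => rfl, fun _ _ _ _ _ => rfl,
  fun _ _ _ _ _ _ _ _ _ => rfl⟩⟩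

/-- The maps of the evaluated ratio factors: joins at odd levels, identities at even levels. [folklore] -/
def joinList (m k : ℕ) : List (NCState (m + 1) → NCState (m + 1)) :=
  (List.range (2 * k)).map fun t => if t % 2 = 0 then genMap m (t + 1) else id

/-- After the joins at levels `1, 3, …, 2k-1` the sites `0, …, k` are all connected. [folklore] -/
theorem compList_joinList_rel {k : ℕ} (hk : k ≤ m) (s : NCState (m + 1)) (i j : Fin (m + 1)) (hi : (i : ℕ) ≤ k)
    (hj : (j : ℕ) ≤ k) : (compList (joinList m k) s).1 i j = true := by
  induction k generalizing i j with
  | zero =>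
    have hij : i = j := Fin.ext (by omega)
    subst hij
    simp only [joinList, Nat.mul_zero, List.range_zero, List.map_nil, compList, List.foldl_nil]
    exact s.2.refl i
  | succ k ih =>
    have hk' : k < m := by omega
    have hl : joinList m (k + 1) = joinList m k ++ [genMap m (2 * k + 1), id] := by
      rw [joinList, show 2 * (k + 1) = 2 * k + 1 + 1 by ring, List.range_succ, List.range_succ, List.append_assoc,
        List.singleton_append, List.map_append, ← joinList]
      congr 1
      rw [List.map_cons, List.map_cons, List.map_nil, if_pos (by omega), if_neg (by omega)]
    rw [hl, compList_append]
    have hr' : ∀ i j : Fin (m + 1), (i : ℕ) ≤ k → (j : ℕ) ≤ k → (compList (joinList m k) s).1 i j = true :=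
      fun i j hi hj => ih (by omega) i j hi hj
    have hrefl : ∀ i : Fin (m + 1), (compList (joinList m k) s).1 i i = true := fun i => (compList (joinList m k) s).2.refl i
    show ((genMap m (2 * k + 1)) (compList (joinList m k) s)).1 i j = true
    have hgen := genMap_odd (m := m) ⟨k, hk'⟩
    simp only at hgen
    rw [hgen, NCState.joinS_val, SiteRel.join_eq_true_iff]
    have hak : ((Fin.castSucc (⟨k, hk'⟩ : Fin m) : Fin (m + 1)) : ℕ) = k := rfl
    have hbk : (((⟨k, hk'⟩ : Fin m).succ : Fin (m + 1)) : ℕ) = k + 1 := rfl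
    -- case analysis on whether `i, j` are the new site `k+1`
    by_cases hik : (i : ℕ) ≤ k <;> by_cases hjk : (j : ℕ) ≤ k
    · exact Or.inl (hr' i j hik hjk)
    · have hj' : j = (⟨k, hk'⟩ : Fin m).succ := Fin.ext (by rw [hbk]; omega)
      refine Or.inr (Or.inl ⟨hr' i _ hik (by rw [hak]), ?_⟩)
      rw [hj']; exact hrefl _
    · have hi' : i = (⟨k, hk'⟩ : Fin m).succ := Fin.ext (by rw [hbk]; omega)
      refine Or.inr (Or.inr ⟨?_, hr' _ j (by rw [hak]) hjk⟩)
      rw [hi']; exact hrefl _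
    · have hij : i = j := Fin.ext (by omega)
      rw [hij]; exact Or.inl (hrefl j)

/-- **The up pass at the special point is the constant map onto the one-block state.** [folklore] -/
theorem compList_joinList_eq_top (s : NCState (m + 1)) : compList (joinList m m) s = topState (m + 1) := by
  apply Subtype.ext
  funext i j
  exact compList_joinList_rel le_rfl s i j (Nat.lt_succ_iff.1 i.2) (Nat.lt_succ_iff.1 j.2)

/-- The special point: `z_n = 2` for odd `n`, `z_n = 2 q²` for even `n`. [folklore] -/
def ipt' (q : ℂ) : ℕ → ℂ := fun n => if n % 2 = 0 then 2 * q ^ 2 else 2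

/-- The polynomial matrix of a descriptor (cleared denominators). [folklore] -/
noncomputable def RpOf (m : ℕ) (q : ℂ) (f : FDesc) : Matrix (NCState (m + 1)) (NCState (m + 1)) (MvPolynomial ℕ ℂ) :=
  RpMat (C q) f.2.1 f.2.2 (genMap m f.1)

/-- The denominator polynomial of a descriptor. [folklore] -/
noncomputable def cPoly (q : ℂ) (f : FDesc) : MvPolynomial ℕ ℂ := C q ^ 2 * f.2.1 ^ 2 - f.2.2 ^ 2

/-- **Specialising a product of cleared factors**: along a ring homomorphism into a field under which no
denominator vanishes, the product of the cleared factors is the product of the denominators times the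
product of the factors. [folklore] -/
theorem map_prod_RpOf {K : Type*} [Field K] (φ : MvPolynomial ℕ ℂ →+* K) (q : ℂ) (l : List FDesc)
    (hl : ∀ f ∈ l, φ (cPoly q f) ≠ 0) :
    ((l.map (RpOf m q)).prod).map φ =
      φ ((l.map (cPoly q)).prod) • (l.map fun f => RfMat (φ (C q)) (φ f.2.1) (φ f.2.2) (genMap m f.1)).prod := by
  induction l with
  | nil => rw [List.map_nil, List.prod_nil, List.map_nil, List.prod_nil, map_one, one_smul, List.map_nil, List.prod_nil,
      Matrix.map_one _ (map_zero φ) (map_one φ)]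
  | cons f l ih =>
    have hf : φ (cPoly q f) ≠ 0 := hl f (by simp)
    rw [List.map_cons, List.prod_cons, Matrix.map_mul, ih (fun g hg => hl g (List.mem_cons_of_mem _ hg)),
      List.map_cons, List.prod_cons, map_mul, List.map_cons, List.prod_cons, RpOf, map_RpMat]
    have hR : RpMat (φ (C q)) (φ f.2.1) (φ f.2.2) (genMap m f.1) =
        φ (cPoly q f) • RfMat (φ (C q)) (φ f.2.1) (φ f.2.2) (genMap m f.1) := by
      rw [RfMat, smul_smul]
      have : φ (cPoly q f) * (φ (C q) ^ 2 * φ f.2.1 ^ 2 - φ f.2.2 ^ 2)⁻¹ = 1 := by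
        rw [cPoly, map_sub, map_mul, map_pow, map_pow, map_pow] at hf ⊢
        exact mul_inv_cancel₀ hf
      rw [this, one_smul]
    rw [hR, Matrix.smul_mul, Matrix.mul_smul, smul_smul]

/-- Mapping a scalar matrix. [folklore] -/
theorem map_smul_one {n : Type*} [DecidableEq n] {R S : Type*} [CommRing R] [CommRing S] (φ : R →+* S) (c : R) :
    (c • (1 : Matrix n n R)).map φ = φ c • (1 : Matrix n n S) := by
  ext i j
  simp only [Matrix.map_apply, Matrix.smul_apply, Matrix.one_apply, smul_eq_mul, mul_ite, mul_one, mul_zero]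
  split_ifs <;> simp

section Values

variable {q : ℂ}

/-- `q ≠ 1`. [folklore] -/
theorem ne_one_of_quad (hq : q ^ 2 + q + 1 = 0) : q ≠ 1 := by
  rintro rfl; norm_num at hq

/-- The evaluated ratio factor at an odd level is the generator. [folklore] -/
theorem RfMat_ratio_even (hq : q ^ 2 + q + 1 = 0) (G : NCState (m + 1) → NCState (m + 1)) :
    RfMat q 2 (2 * q ^ 2) G = mapMat ℂ G := by
  have hq0 := ne_zero_of_quad hq
  have ha : q ^ 2 * (2 * q ^ 2) ^ 2 - (2 : ℂ) ^ 2 = 0 := by linear_combination 4 * (q - 1) * (q ^ 3 + 1) * hq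
  have hcb : q ^ 2 * (2 : ℂ) ^ 2 - (2 * q ^ 2) ^ 2 = -(q * ((2 : ℂ) ^ 2 - (2 * q ^ 2) ^ 2)) := by
    linear_combination (-4 * q * (q + 1) * (q - 1)) * hq
  have hc : q ^ 2 * (2 : ℂ) ^ 2 - (2 * q ^ 2) ^ 2 ≠ 0 := by
    rw [show q ^ 2 * (2 : ℂ) ^ 2 - (2 * q ^ 2) ^ 2 = 4 * q ^ 2 * (1 - q ^ 2) by ring]
    exact mul_ne_zero (mul_ne_zero (by norm_num) (pow_ne_zero 2 hq0)) (sub_ne_zero.2 (sq_ne_one_of_quad hq (by norm_num)).symm)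
  rw [RfMat, RpMat, ha, zero_smul, zero_sub, ← neg_smul, ← hcb, inv_smul_smul₀ hc]

/-- The evaluated ratio factor at an even level is the identity. [folklore] -/
theorem RfMat_ratio_odd (hq : q ^ 2 + q + 1 = 0) (G : NCState (m + 1) → NCState (m + 1)) : RfMat q 2 2 G = 1 := by
  have hc : q ^ 2 * (2 : ℂ) ^ 2 - (2 : ℂ) ^ 2 ≠ 0 := by
    rw [show q ^ 2 * (2 : ℂ) ^ 2 - 2 ^ 2 = 4 * (q ^ 2 - 1) by ring]
    exact mul_ne_zero (by norm_num) (sub_ne_zero.2 (sq_ne_one_of_quad hq (by norm_num)))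
  rw [RfMat, RpMat, sub_self, mul_zero, zero_smul, sub_zero, inv_smul_smul₀ hc]

/-- The denominators of the product factors do not vanish at the special point. [folklore] -/
theorem denom_prod_ne_zero (hq : q ^ 2 + q + 1 = 0) {x y : ℂ} (hx : x = 2 ∨ x = 2 * q ^ 2) (hy : y = 2 ∨ y = 2 * q ^ 2) :
    q ^ 2 * (x * y) ^ 2 - 1 ^ 2 ≠ 0 := by
  have hq3 := cube_eq_one_of_quad hq
  have h16 : 16 * q - 1 ≠ 0 := by
    intro h
    have h1 : q = 1 / 16 := by linear_combination h / 16
    rw [h1] at hq; norm_num at hq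
  have h16' : 16 * q ^ 2 - 1 ≠ 0 := by
    intro h
    have h1 : q = -17 / 16 := by linear_combination hq - h / 16
    rw [h1] at h; norm_num at h
  rcases hx with rfl | rfl <;> rcases hy with rfl | rfl
  · rwa [show q ^ 2 * ((2 : ℂ) * 2) ^ 2 - 1 ^ 2 = 16 * q ^ 2 - 1 by ring]
  · rw [show q ^ 2 * (2 * (2 * q ^ 2)) ^ 2 - 1 ^ 2 = 16 * (q ^ 3) ^ 2 - 1 by ring, hq3]; norm_num
  · rw [show q ^ 2 * (2 * q ^ 2 * 2) ^ 2 - 1 ^ 2 = 16 * (q ^ 3) ^ 2 - 1 by ring, hq3]; norm_num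
  · rwa [show q ^ 2 * (2 * q ^ 2 * (2 * q ^ 2)) ^ 2 - 1 ^ 2 = 16 * q * (q ^ 3) ^ 3 - 1 by ring, hq3,
      show (16 : ℂ) * q * 1 ^ 3 - 1 = 16 * q - 1 by ring]

/-- Values of the special point. [folklore] -/
theorem ipt'_mem (q : ℂ) (n : ℕ) : ipt' q n = 2 ∨ ipt' q n = 2 * q ^ 2 := by
  unfold ipt'; split_ifs
  · exact Or.inr rfl
  · exact Or.inl rfl

end Values

/-- The final list of descriptors of the cocycle matrix. [folklore] -/
noncomputable def finalList (m : ℕ) : List FDesc :=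
  ((List.range (2 * m)).map fun t => ((t + 1, X 1, X (t + 2)) : FDesc)) ++ prodList m (2 * m)

/-- **No denominator of the cocycle matrix vanishes at the special point.** [folklore] -/
theorem eval_cPoly_ne_zero {q : ℂ} (hq : q ^ 2 + q + 1 = 0) : ∀ f ∈ finalList m, eval (ipt' q) (cPoly q f) ≠ 0 := by
  intro f hf
  rw [finalList, List.mem_append] at hf
  rcases hf with hf | hf
  · obtain ⟨t, -, rfl⟩ := List.mem_map.1 hf
    simp only [cPoly, map_sub, map_mul, map_pow, eval_C, eval_X]
    have h1 : ipt' q 1 = 2 := by simp [ipt']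
    rw [h1]
    rcases Nat.mod_two_eq_zero_or_one t with ht | ht
    · have h2 : ipt' q (t + 2) = 2 * q ^ 2 := by simp [ipt', ht]
      rw [h2, show q ^ 2 * (2 : ℂ) ^ 2 - (2 * q ^ 2) ^ 2 = 4 * q ^ 2 * (1 - q ^ 2) by ring]
      exact mul_ne_zero (mul_ne_zero (by norm_num) (pow_ne_zero 2 (ne_zero_of_quad hq)))
        (sub_ne_zero.2 (sq_ne_one_of_quad hq (by norm_num)).symm)
    · have h2 : ipt' q (t + 2) = 2 := by simp [ipt', ht]
      rw [h2, show q ^ 2 * (2 : ℂ) ^ 2 - 2 ^ 2 = 4 * (q ^ 2 - 1) by ring]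
      exact mul_ne_zero (by norm_num) (sub_ne_zero.2 (sq_ne_one_of_quad hq (by norm_num)))
  · obtain ⟨a, b, -, -, -, -, -, hN, hD⟩ := goodP_prodList le_rfl f hf
    simp only [cPoly, hN, hD, map_sub, map_mul, map_pow, eval_C, eval_X, map_one]
    exact denom_prod_ne_zero hq (ipt'_mem q a) (ipt'_mem q b)

/-- **The evaluated ratio factors multiply to the constant map onto the one-block state.** [folklore] -/
theorem prod_ratio_eval {q : ℂ} (hq : q ^ 2 + q + 1 = 0) :
    (((List.range (2 * m)).map fun t => ((t + 1, X 1, X (t + 2)) : FDesc)).map fun f =>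
        RfMat (eval (ipt' q) (C q)) (eval (ipt' q) f.2.1) (eval (ipt' q) f.2.2) (genMap m f.1)).prod =
      mapMat ℂ (fun _ : NCState (m + 1) => topState (m + 1)) := by
  rw [List.map_map]
  have hl : ((List.range (2 * m)).map ((fun f : FDesc =>
        RfMat (eval (ipt' q) (C q)) (eval (ipt' q) f.2.1) (eval (ipt' q) f.2.2) (genMap m f.1)) ∘
        fun t => ((t + 1, X 1, X (t + 2)) : FDesc))) = (joinList m m).map (mapMat ℂ) := by
    rw [joinList, List.map_map]
    refine List.map_congr_left fun t _ => ?_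
    simp only [Function.comp_apply, eval_C, eval_X]
    have h1 : ipt' q 1 = 2 := by simp [ipt']
    rw [h1]
    rcases Nat.mod_two_eq_zero_or_one t with ht | ht
    · have h2 : ipt' q (t + 2) = 2 * q ^ 2 := by simp [ipt', ht]
      rw [h2, RfMat_ratio_even hq, if_pos ht]
    · have h2 : ipt' q (t + 2) = 2 := by simp [ipt', ht]
      rw [h2, RfMat_ratio_odd hq, if_neg (by omega), mapMat_id]
  rw [hl, prod_map_mapMat]
  congr 1
  funext s
  exact compList_joinList_eq_top s

/-- **The left kernel of `M_⊤ S - 1` is a line** for any `S` preserving total mass. [folklore] -/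
theorem vecMul_const_mul_line {S : Matrix (NCState (m + 1)) (NCState (m + 1)) ℂ}
    (hS : ∀ x : NCState (m + 1) → ℂ, ∑ s', (x ᵥ* S) s' = ∑ s, x s) (x : NCState (m + 1) → ℂ)
    (hx : x ᵥ* (mapMat ℂ (fun _ : NCState (m + 1) => topState (m + 1)) * S - 1) = 0) :
    ∃ a : ℂ, x = a • ((Pi.single (topState (m + 1)) (1 : ℂ)) ᵥ* S) := by
  refine ⟨∑ s, x s, ?_⟩
  have h : x ᵥ* (mapMat ℂ (fun _ : NCState (m + 1) => topState (m + 1)) * S) = x := by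
    rw [vecMul_sub, vecMul_one, sub_eq_zero] at hx; exact hx
  have _ := hS
  conv_lhs => rw [← h]
  rw [← Matrix.vecMul_vecMul, vecMul_mapMat_const x (fun _ => rfl), Matrix.smul_vecMul]

/-- **The adjugate of `Y - 1` is not zero**: the eigenvalue `1` of the cocycle matrix is geometrically
simple. [cite: IkhlefPonsaing2012, §3.4] -/
theorem adjugate_cocycleY_sub_one_ne_zero {q : ℂ} (hq : q ^ 2 + q + 1 = 0) :
    adjugate (cocycleY m q - 1) ≠ 0 := by
  have hY : cocycleY m q = prodD m q (finalList m) := cocycleY_eq_prodD q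
  set l := finalList m with hl
  set Mp : Matrix (NCState (m + 1)) (NCState (m + 1)) (MvPolynomial ℕ ℂ) := (l.map (RpOf m q)).prod with hMp
  set cp : MvPolynomial ℕ ℂ := (l.map (cPoly q)).prod with hcp
  have hne : ∀ f ∈ l, eval (ipt' q) (cPoly q f) ≠ 0 := eval_cPoly_ne_zero hq
  have hneRF : ∀ f ∈ l, toRF ℂ (cPoly q f) ≠ 0 := fun f hf => toRF_ne_zero_of_eval _ (hne f hf)
  -- over the rapidity field: `Mp ↦ cp • Y`
  have h1 : Mp.map (toRF ℂ) = toRF ℂ cp • cocycleY m q := by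
    rw [hMp, map_prod_RpOf (toRF ℂ) q l hneRF, hY, prodD]
    rfl
  have hcpRF : toRF ℂ cp ≠ 0 := by
    rw [hcp, map_list_prod, List.map_map]
    refine List.prod_ne_zero fun h0 => ?_
    obtain ⟨f, hf, hf0⟩ := List.mem_map.1 h0
    exact hneRF f hf hf0
  -- at the special point: `Mp ↦ cp(z⁰) • (M_⊤ * S)`
  set S : Matrix (NCState (m + 1)) (NCState (m + 1)) ℂ := ((prodList m (2 * m)).map fun f =>
    RfMat (eval (ipt' q) (C q)) (eval (ipt' q) f.2.1) (eval (ipt' q) f.2.2) (genMap m f.1)).prod with hS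
  have h2 : Mp.map (eval (ipt' q)) = eval (ipt' q) cp • (mapMat ℂ (fun _ : NCState (m + 1) => topState (m + 1)) * S) := by
    rw [hMp, map_prod_RpOf (eval (ipt' q)) q l hne]
    congr 1
    rw [hl, finalList, List.map_append, List.prod_append, prod_ratio_eval hq]
  have hcpC : eval (ipt' q) cp ≠ 0 := by
    rw [hcp, map_list_prod, List.map_map]
    refine List.prod_ne_zero fun h0 => ?_
    obtain ⟨f, hf, hf0⟩ := List.mem_map.1 h0
    exact hne f hf hf0
  have hSsum : ∀ x : NCState (m + 1) → ℂ, ∑ s', (x ᵥ* S) s' = ∑ s, x s := by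
    intro x
    rw [hS]
    have := sum_vecMul_list_prod_RfMat (q := eval (ipt' q) (C q)) (by rw [eval_C]; exact hq)
      ((prodList m (2 * m)).map fun f => (eval (ipt' q) f.2.1, eval (ipt' q) f.2.2, genMap m f.1))
      (fun g hg => by
        obtain ⟨f, hf, rfl⟩ := List.mem_map.1 hg
        have h := hne f (by rw [hl, finalList]; exact List.mem_append_right _ hf)
        simp only [cPoly, map_sub, map_mul, map_pow, eval_C] at h
        simpa only [eval_C] using h) x
    rw [List.map_map] at this
    exact this
  -- suppose the adjugate vanishes over the rapidity field
  intro h0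
  have h3 : adjugate (Mp - cp • (1 : Matrix _ _ (MvPolynomial ℕ ℂ))) = 0 := by
    have h3' : (toRF ℂ).mapMatrix (adjugate (Mp - cp • 1)) = 0 := by
      rw [RingHom.map_adjugate, RingHom.mapMatrix_apply, Matrix.map_sub _ (map_sub (toRF ℂ)), h1, map_smul_one,
        ← smul_sub, adjugate_smul, h0, smul_zero]
    refine Matrix.ext fun i j => ?_
    have := congrArg (fun M : Matrix _ _ (RapidityField ℂ) => M i j) h3'
    simp only [RingHom.mapMatrix_apply, Matrix.map_apply, Matrix.zero_apply] at this
    rw [Matrix.zero_apply]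
    exact toRF_injective (by rw [this, map_zero])
  -- evaluate: the adjugate of `M_⊤ S - 1` would vanish
  have h4 : adjugate (mapMat ℂ (fun _ : NCState (m + 1) => topState (m + 1)) * S - 1) = 0 := by
    have h4' : (eval (ipt' q)).mapMatrix (adjugate (Mp - cp • 1)) = 0 := by rw [h3, map_zero]
    rw [RingHom.map_adjugate, RingHom.mapMatrix_apply, Matrix.map_sub _ (map_sub (eval (ipt' q))), h2, map_smul_one,
      ← smul_sub, adjugate_smul, smul_eq_zero] at h4'
    rcases h4' with h | h
    · exact absurd h (pow_ne_zero _ hcpC)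
    · exact h
  exact Literature.LinearAlgebra.Matrix.adjugate_ne_zero_of_vecMul_line _ _ (vecMul_const_mul_line hSsum)
    (topState (m + 1)) h4

end SpecialPoint

/-! ### Conclusions: uniqueness up to a factor -/

section Conclusions

open _root_.Matrix MvPolynomial Literature.LinearAlgebra.Matrix

variable {m : ℕ}

/-- **Uniqueness of the exact boundary qKZ solution on the connectivity basis**: any two solutions of
the exact system (all bulk levels `1 ≤ i ≤ 2m`, both reflections with the same monomial twist `a`)
are proportional over the rapidity field. [cite: IkhlefPonsaing2012, §3.4 (20)–(22)] -/
theorem ncQKZ_solutions_proportional {q : ℂ} (hq : q ^ 2 + q + 1 = 0) {v v' : NCState (m + 1) → RapidityField ℂ}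
    {a : ℤ}
    (hex : ∀ i, 1 ≤ i → i ≤ 2 * m → ∀ s, genSwap ℂ i (v s) = (v ᵥ* ncR m q i (genZ ℂ i) (genZ ℂ (i + 1))) s)
    (hbot : ∀ s, genInv ℂ 1 (v s) = genZ ℂ 1 ^ (2 * a) * v s)
    (htop : ∀ s, genInv ℂ (2 * m + 1) (v s) = genZ ℂ (2 * m + 1) ^ (2 * a) * v s)
    (hex' : ∀ i, 1 ≤ i → i ≤ 2 * m → ∀ s, genSwap ℂ i (v' s) = (v' ᵥ* ncR m q i (genZ ℂ i) (genZ ℂ (i + 1))) s)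
    (hbot' : ∀ s, genInv ℂ 1 (v' s) = genZ ℂ 1 ^ (2 * a) * v' s)
    (htop' : ∀ s, genInv ℂ (2 * m + 1) (v' s) = genZ ℂ (2 * m + 1) ^ (2 * a) * v' s) (k : NCState (m + 1)) :
    v' k • v = v k • v' :=
  vecMul_proportional_of_adjugate_ne_zero _ (adjugate_cocycleY_sub_one_ne_zero hq)
    (ncSolution_vecMul_cocycleY hex hbot htop) (ncSolution_vecMul_cocycleY hex' hbot' htop') k

/-- **Uniqueness of the exact boundary qKZ solution, pattern level**: any two vectors supported on the
physical sector which solve IP12's system (20)–(22) exactly — the bulk exchange relations at all levels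
(joins at odd levels, isolations at even levels) and the two reflections with the same monomial twist —
are proportional over the rapidity field. This is the rigorous form of "the solution of the qKZ system is
unique up to normalisation". [cite: IkhlefPonsaing2012, §3.4 (20)–(22)] -/
theorem qKZ_solutions_proportional {q : ℂ} (hq : q ^ 2 + q + 1 = 0) {ψ ψ' : ColPattern m → RapidityField ℂ} {a : ℤ}
    (hsupp : ∀ Q, ψ Q ≠ 0 → IsValid 0 Q ∧ IsPlanar Q ∧ lump Q = Q)
    (hodd : ∀ j' : Fin m, IsExactExchange q (2 * (j' : ℕ) + 1) (cpJoin (Fin.castSucc j') j'.succ) ψ)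
    (heven : ∀ b0 : Fin m, IsExactExchange q (2 * (b0 : ℕ) + 2) (cpIsolate b0.succ) ψ)
    (hbot : ∀ Q, genInv ℂ 1 (ψ Q) = genZ ℂ 1 ^ (2 * a) * ψ Q)
    (htop : ∀ Q, genInv ℂ (2 * m + 1) (ψ Q) = genZ ℂ (2 * m + 1) ^ (2 * a) * ψ Q)
    (hsupp' : ∀ Q, ψ' Q ≠ 0 → IsValid 0 Q ∧ IsPlanar Q ∧ lump Q = Q)
    (hodd' : ∀ j' : Fin m, IsExactExchange q (2 * (j' : ℕ) + 1) (cpJoin (Fin.castSucc j') j'.succ) ψ')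
    (heven' : ∀ b0 : Fin m, IsExactExchange q (2 * (b0 : ℕ) + 2) (cpIsolate b0.succ) ψ')
    (hbot' : ∀ Q, genInv ℂ 1 (ψ' Q) = genZ ℂ 1 ^ (2 * a) * ψ' Q)
    (htop' : ∀ Q, genInv ℂ (2 * m + 1) (ψ' Q) = genZ ℂ (2 * m + 1) ^ (2 * a) * ψ' Q) (k : ColPattern m) :
    ψ' k • ψ = ψ k • ψ' := by
  have hnc : ∀ s₀, ncVec ψ' s₀ • ncVec ψ = ncVec ψ s₀ • ncVec ψ' := fun s₀ =>
    ncQKZ_solutions_proportional hq (v := ncVec ψ) (v' := ncVec ψ')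
      (fun i hi1 hi2 s => ncExchange_matrix hq hsupp hodd heven hi1 hi2 s) (fun s => hbot _) (fun s => htop _)
      (fun i hi1 hi2 s => ncExchange_matrix hq hsupp' hodd' heven' hi1 hi2 s) (fun s => hbot' _) (fun s => htop' _) s₀
  have hz : ∀ Q, ¬ (IsValid 0 Q ∧ IsPlanar Q ∧ lump Q = Q) → ψ Q = 0 := fun Q h => by
    by_contra h'; exact h (hsupp Q h')
  have hz' : ∀ Q, ¬ (IsValid 0 Q ∧ IsPlanar Q ∧ lump Q = Q) → ψ' Q = 0 := fun Q h => by
    by_contra h'; exact h (hsupp' Q h')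
  funext Q
  simp only [Pi.smul_apply, smul_eq_mul]
  by_cases hk : IsValid 0 k ∧ IsPlanar k ∧ lump k = k
  · obtain ⟨s₀, rfl⟩ := exists_cpOf_eq hk
    by_cases hQ : IsValid 0 Q ∧ IsPlanar Q ∧ lump Q = Q
    · obtain ⟨s, rfl⟩ := exists_cpOf_eq hQ
      have := congrFun (hnc s₀) s
      simpa only [Pi.smul_apply, smul_eq_mul, ncVec] using this
    · rw [hz Q hQ, hz' Q hQ, mul_zero, mul_zero]
  · rw [hz k hk, hz' k hk, zero_mul, zero_mul]

/-- A generator of the rapidity field is not a root of unity. [folklore] -/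
theorem genZ_zpow_eq_one {k : ℕ} {d : ℤ} (h : genZ ℂ k ^ d = 1) : d = 0 := by
  have key : ∀ n : ℕ, genZ ℂ k ^ n = 1 → n = 0 := by
    intro n hn
    have h1 : (X k : MvPolynomial ℕ ℂ) ^ n = 1 := by
      apply toRF_injective
      rw [map_pow, map_one]; exact hn
    have h2 := congrArg (eval fun _ => (2 : ℂ)) h1
    rw [map_pow, eval_X, map_one] at h2
    by_contra hn0
    have : (2 : ℂ) ^ n = 2 ^ (n : ℕ) := rfl
    have h3 : (2 : ℝ) ^ n = 1 := by exact_mod_cast h2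
    have h4 : (1 : ℝ) < 2 ^ n := one_lt_pow₀ (by norm_num) hn0
    linarith
  rcases Int.eq_nat_or_neg d with ⟨n, rfl | rfl⟩
  · rw [zpow_natCast] at h
    rw [key n h]; rfl
  · rw [_root_.zpow_neg, zpow_natCast, inv_eq_one] at h
    rw [key n h]; rfl

/-- **The exact ground state with equal twists**: the primitive polynomial `t`-fixed vector `P` of this
development solves IP12's system (20)–(22) exactly with the SAME monomial twist `z^{2a}` at both
reflections (the exponents agree because the sum `Z = Σ_Q P_Q ≠ 0` is `S_L`-symmetric), and its sum is
`S_L`-symmetric at the polynomial level. [cite: IkhlefPonsaing2012, §3.4 (20)–(22), Prop. 3.4 (proof)] -/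
theorem exists_groundState_exact_sameTwist {q : ℂ} (hq : q ^ 2 + q + 1 = 0) :
    ∃ (P : ColPattern m → MvPolynomial ℕ ℂ) (a : ℤ), PolyPrimitive P ∧
      (∀ Q', ∑ Q, ipTransferMatrixW m (genC ℂ q) (genW ℂ) (genZ ℂ) Q Q' * toRF ℂ (P Q) = toRF ℂ (P Q')) ∧
      (∀ j' : Fin m, IsExactExchange q (2 * (j' : ℕ) + 1) (cpJoin (Fin.castSucc j') j'.succ) (fun Q => toRF ℂ (P Q))) ∧
      (∀ b0 : Fin m, IsExactExchange q (2 * (b0 : ℕ) + 2) (cpIsolate b0.succ) (fun Q => toRF ℂ (P Q))) ∧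
      (∀ Q, genInv ℂ (2 * m + 1) (toRF ℂ (P Q)) = genZ ℂ (2 * m + 1) ^ (2 * a) * toRF ℂ (P Q)) ∧
      (∀ Q, genInv ℂ 1 (toRF ℂ (P Q)) = genZ ℂ 1 ^ (2 * a) * toRF ℂ (P Q)) ∧
      (∀ a₁ b₁ : ℕ, 1 ≤ a₁ → a₁ ≤ b₁ → b₁ ≤ 2 * m + 1 → rename (Equiv.swap a₁ b₁) (∑ Q, P Q) = ∑ Q, P Q) := by
  obtain ⟨P, a, a', hprim, hP, hodd, heven, htop, hbot, hsym⟩ := exists_groundState_exact_sumSymmetric (m := m) hq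
  have hP0 : P ≠ 0 := by
    obtain ⟨Q₀, hQ₀⟩ := hprim.exists_ne_zero
    intro h; exact hQ₀ (congrFun h Q₀)
  have hZ : toRF ℂ (∑ Q, P Q) ≠ 0 := fun h =>
    groundState_sum_ne_zero hq hP0 hP (toRF_injective (h.trans (map_zero _).symm))
  have h1 : genInv ℂ (2 * m + 1) (toRF ℂ (∑ Q, P Q)) = genZ ℂ (2 * m + 1) ^ (2 * a') * toRF ℂ (∑ Q, P Q) :=
    sum_genInv_covariant hbot hsym (by omega) le_rfl
  have h2 : genInv ℂ (2 * m + 1) (toRF ℂ (∑ Q, P Q)) = genZ ℂ (2 * m + 1) ^ (2 * a) * toRF ℂ (∑ Q, P Q) := by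
    have := genInv_ipZsum_of_zpow htop
    simpa only [ipZsum, map_sum] using this
  have h3 : genZ ℂ (2 * m + 1) ^ (2 * a) = genZ ℂ (2 * m + 1) ^ (2 * a') := mul_right_cancel₀ hZ (h2.symm.trans h1)
  have h4 : genZ ℂ (2 * m + 1) ^ (2 * a - 2 * a') = 1 := by
    rw [zpow_sub₀ (genZ_ne_zero _), h3, div_self (zpow_ne_zero _ (genZ_ne_zero _))]
  have haa : a = a' := by have := genZ_zpow_eq_one h4; omega
  subst haa
  exact ⟨P, a, hprim, hP, hodd, heven, htop, hbot, hsym⟩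

/-- **Every exact solution supported on the physical sector is a multiple of the ground state**: with
`P, a` as in `exists_groundState_exact_sameTwist`, any `ψ'` supported on the physical sector that solves
the exact system with twist `a` is `c · P` for some `c` in the rapidity field.
[cite: IkhlefPonsaing2012, §3.4 (20)–(22)] -/
theorem qKZ_solution_eq_smul_groundState {q : ℂ} (hq : q ^ 2 + q + 1 = 0) {P : ColPattern m → MvPolynomial ℕ ℂ}
    {a : ℤ} (hprim : PolyPrimitive P)
    (hP : ∀ Q', ∑ Q, ipTransferMatrixW m (genC ℂ q) (genW ℂ) (genZ ℂ) Q Q' * toRF ℂ (P Q) = toRF ℂ (P Q'))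
    (hodd : ∀ j' : Fin m, IsExactExchange q (2 * (j' : ℕ) + 1) (cpJoin (Fin.castSucc j') j'.succ) (fun Q => toRF ℂ (P Q)))
    (heven : ∀ b0 : Fin m, IsExactExchange q (2 * (b0 : ℕ) + 2) (cpIsolate b0.succ) (fun Q => toRF ℂ (P Q)))
    (htop : ∀ Q, genInv ℂ (2 * m + 1) (toRF ℂ (P Q)) = genZ ℂ (2 * m + 1) ^ (2 * a) * toRF ℂ (P Q))
    (hbot : ∀ Q, genInv ℂ 1 (toRF ℂ (P Q)) = genZ ℂ 1 ^ (2 * a) * toRF ℂ (P Q))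
    {ψ' : ColPattern m → RapidityField ℂ}
    (hsupp' : ∀ Q, ψ' Q ≠ 0 → IsValid 0 Q ∧ IsPlanar Q ∧ lump Q = Q)
    (hodd' : ∀ j' : Fin m, IsExactExchange q (2 * (j' : ℕ) + 1) (cpJoin (Fin.castSucc j') j'.succ) ψ')
    (heven' : ∀ b0 : Fin m, IsExactExchange q (2 * (b0 : ℕ) + 2) (cpIsolate b0.succ) ψ')
    (hbot' : ∀ Q, genInv ℂ 1 (ψ' Q) = genZ ℂ 1 ^ (2 * a) * ψ' Q)
    (htop' : ∀ Q, genInv ℂ (2 * m + 1) (ψ' Q) = genZ ℂ (2 * m + 1) ^ (2 * a) * ψ' Q) :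
    ∃ c : RapidityField ℂ, ∀ Q, ψ' Q = c * toRF ℂ (P Q) := by
  have hψ0 : (fun Q => toRF ℂ (P Q)) ≠ 0 := by
    obtain ⟨Q₀, hQ₀⟩ := hprim.exists_ne_zero
    intro h; exact hQ₀ (toRF_injective ((congrFun h Q₀).trans (map_zero _).symm))
  refine exists_scalar_of_proportional (fun k => ?_) hψ0
  exact qKZ_solutions_proportional hq (fun Q hQ => groundState_support hq hP hQ) hodd heven hbot htop hsupp' hodd'
    heven' hbot' htop' k

end Conclusions






end Literature.Probability.Percolation
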